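import Literature.NumberTheory.ComplexMultiplication.CMTypeDictionaryGroupLevel
import Literature.NumberTheory.ComplexMultiplication.QuarticCMTypes
import Literature.AlgebraicGeometry.ComplexMultiplication.SimpleIffPrimitiveCMType
import HarnessLib

/-!
# Primitive CM types of an ABELIAN CM field are those of full reflex degree (Schmidt 1984, Kap. II Bem. 1.13)

Layer `Literature/NumberTheory/ComplexMultiplication`; KERNEL ONLY (theorems; no definition, no named fact, net debt
0; D-0026).  Sequel of `PrimitiveCMTypeExistenceNonGalois` (Satz 1.6) and of `QuarticCMTypes` §6 (Shimura §8.4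
Example (1)) in the same dictionary.

Schmidt, LNM 1082, Kap. II Bem. 1.13 (held `book:schmidtnd-arithmetik-abelscher-varietaten-mit-komplexer-
multiplikation`, chunk p0032 L30): «Für absolut Abelsches `K` ist `(K,H)` primitiv genau dann, wenn `K = K'` ist»
— for a CM field `K` ABELIAN over `ℚ`, a CM type is primitive iff its reflex field `K'` is `K` itself; «Dass dies
Kriterium für normales `K` i. allg. in jeder Richtung falsch ist» is Schmidt's example with `Gal = ℤ/2 × 𝔄₅`
(p0033), not formalised here.  The mechanism (proof of Bem. 1.12 / Def. 1.3): `K'` is the fixed field of the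
LEFT stabiliser `W' = {γ | γS = S} = H*` of the half-system `S`, primitivity is triviality of the RIGHT stabiliser
`W = {γ | Sγ = S} = H'`, and for an abelian Galois group `W = W'`.

* §1 **group level**: for a commutative `G` acting transitively, Shimura's `H' = Stab(S*)` equals `H* = Stab(Φ)`
  — this is the TREE's `QuarticCMTypes.stabilizer_reflexLift_eq_stabilizer_of_comm` (Shimura §8.4 Example (1)),
  imported, not restated; hence `IsPrimitive G Φ φh ↔ Stab(Φ) ≤ Stab(φh)` (`isPrimitive_iff_stabilizer_le_of_comm`,
  Prop. 26 `H₁ ⊇ H'` read with `H' = H*`).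
* §1b **Bem. 1.12** «primitiv genau dann, wenn `K = K''`»: for any finite Galois `Ω/F`, `Φ ⊆ Hom_F(K, Ω)` is
  primitive at `φ` iff the fixed field of `H'` is `φ(K)` (`isPrimitive_iff_fixedField_stabilizer_reflexLift_eq`;
  the tree had the implication `⟹`).
* §2 **Galois level** (`K/ℚ` abelian, `Gal(K/ℚ)` on `Hom_ℚ(K, K)`, point stabilisers trivial): a half-system
  `Ψ` is primitive iff `Stab(Ψ) = 1` iff `|Gal(K/ℚ) • Ψ| = [K : ℚ]` iff **`[K* : ℚ] = [K : ℚ]`** for the tree's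
  reflex field `K* = reflexField ℚ K Ψ ≤ K` (`isPrimitive_iff_finrank_reflexField_eq`, via the dictionary's
  `finrank_reflexField_eq_card_orbit`), iff `K* = ⊤`.
* §3 **complex CM types** `Θ : CMType K` of an abelian CM field: `IsPrimitive (ℂ ≃+* ℂ) Θ φ₀` iff
  `[K*_Θ : ℚ] = [K : ℚ]` (`isPrimitive_iff_finrank_reflexField_algValuedIn_eq`, through the tree's
  `QuarticCMTypes.isPrimitive_algValuedIn_iff`), iff `K*_Θ = ⊤` (the tree had `⟹`:
  `QuarticCMTypes.reflexField_eq_top_of_isPrimitive_of_comm`, Shimura §8.4 Example (1); Schmidt's «genau dann» is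
  the new `⟸`), iff Shimura's complex reflex field `ℚ(tr_Θ(K)) ⊂ ℂ` (`traceField`, §8.3 Prop. 28; its degree is
  `[K* : ℚ]` by the tree's `finrank_traceField_eq_finrank_reflexField`) has degree `[K : ℚ]`
  (`isPrimitive_iff_finrank_traceField_eq`); with `isSimple_iff_isPrimitive` (Prop. 26 on varieties): an abelian
  variety of CM type `(K; Θ)`, `K` abelian, is simple iff `[ℚ(tr_Θ(K)) : ℚ] = [K : ℚ]`
  (`isSimple_iff_finrank_traceField_eq`).

Reused by import, not restated (cell E-DEDUP): reflex degree = orbit size = `(G : H*)`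
(`CMTypeDictionaryGroupLevel.finrank_reflexField_eq_card_orbit`), `H' = H*` for commutative `G`
(`QuarticCMTypes` §6), Prop. 26 ⟺ «not induced» (`NonPrimitiveCMTypeInduced.primitive_iff_not_exists_inducedCMType`),
`Kʳʳ = K` for a primitive type (`EmbeddingAction.IsPrimitive.fixedField_stabilizer_reflexLift_eq`).

## References

* [Schmidt1984CMArithmetik] C.-G. Schmidt, *Arithmetik abelscher Varietäten mit komplexer Multiplikation*, LNM
  1082 (1984), Kap. II Def. 1.3, Prop. 1.10, Def. 1.11, Bem. 1.12, Bem. 1.13 (chunk p0031–p0032).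
* [Shimura1998] G. Shimura, *Abelian Varieties with Complex Multiplication and Modular Functions*, §8.2 Prop. 26,
  §8.3 Prop. 28, §8.4 Example (2)(A).

## Provenance

Cell `pub-hodgecm2` (COR-CM), literature seat `lit-deligne-3` gen 23 (PORTFOLIO-PASS «Deligne 1982 continued:
CM-type combinatorics»; claim SCHAPPACHER-NONGALOIS, addendum ABELIAN-REFLEX; count-neutral, theorems only).
-/

set_option autoImplicit false

noncomputable section

open scoped Classical Pointwise

namespace Literature.NumberTheory.ComplexMultiplication

namespace PrimitiveCMTypeAbelianReflex

open CategoryTheory (End)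
open NumberField NumberField.ComplexEmbedding
open Literature.AlgebraicGeometry.Motives (AbelianVariety CMType)
open Literature.AlgebraicGeometry.ComplexMultiplication (IsCMTypeRealisation isSimple_iff_isPrimitive)
open Literature.AlgebraicGeometry.HodgeTheory

/-! ## §1 Group level: for commutative `G`, `H' = H*` -/

section GroupLevel

variable {G : Type*} [Group G] {E : Type*} [MulAction G E]

/-- For a commutative group acting transitively, **`Φ` is primitive at `φh` iff `H* = Stab(Φ) ≤ Stab(φh)`**:
Shimura's Prop. 26 criterion on `H' = Stab(S*)` (tree `isPrimitive_iff`) read through `H' = H*` (tree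
`stabilizer_reflexLift_eq_stabilizer_of_comm`, §8.4 Example (1)) — the `W = W'` behind Schmidt's Bem. 1.13.
[cite: Schmidt1984CMArithmetik, Kap. II Bem. 1.13] [cite: Shimura1998, §8.4 Example (1)] -/
theorem isPrimitive_iff_stabilizer_le_of_comm [MulAction.IsPretransitive G E] (hc : ∀ a b : G, a * b = b * a)
    (Φ : Set E) (φh : E) : IsPrimitive G Φ φh ↔ MulAction.stabilizer G Φ ≤ MulAction.stabilizer G φh := by
  rw [isPrimitive_iff, stabilizer_reflexLift_eq_stabilizer_of_comm hc]

end GroupLevel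

/-! ## §1b Bem. 1.12: primitive iff `K'' = K` (any Galois `Ω/F`, no commutativity) -/

section Bidual

variable {F K Ω : Type*} [Field F] [Field K] [Field Ω] [Algebra F K] [Algebra F Ω]

/-- **Schmidt Bem. 1.12 «(K,H) ist primitiv genau dann, wenn K = K'' ist»**: for `Ω/F` finite Galois and
`φ : K →ₐ[F] Ω`, the type `Φ ⊆ Hom_F(K, Ω)` is primitive at `φ` iff the reflex field of the reflex type — the
fixed field of `H' = Stab(S*)` («`K''` ist der Fixkörper von `W`») — is `φ(K)` itself (the tree had `⟹`,
`IsPrimitive.fixedField_stabilizer_reflexLift_eq`; `⟸` is the Galois correspondence).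
[cite: Schmidt1984CMArithmetik, Kap. II Bem. 1.12] -/
theorem isPrimitive_iff_fixedField_stabilizer_reflexLift_eq [IsGalois F Ω] [FiniteDimensional F Ω]
    (Φ : Set (K →ₐ[F] Ω)) (φ : K →ₐ[F] Ω) :
    IsPrimitive (Ω ≃ₐ[F] Ω) Φ φ ↔
      IntermediateField.fixedField
          (MulAction.stabilizer (Ω ≃ₐ[F] Ω) (reflexLift Φ φ : Set (Ω ≃ₐ[F] Ω))) = φ.fieldRange := by
  refine ⟨fun h => h.fixedField_stabilizer_reflexLift_eq, fun h => ?_⟩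
  rw [isPrimitive_iff]
  have h' := congr_arg IntermediateField.fixingSubgroup h
  rw [IntermediateField.fixingSubgroup_fixedField, ← stabilizer_algHom_eq_fixingSubgroup] at h'
  exact h'.le

end Bidual

/-! ## §2 Galois level: `K/ℚ` abelian, `Gal(K/ℚ)` acting on `Hom_ℚ(K, K)` -/

section GalLevel

variable {K : Type} [Field K] [NumberField K]

/-- `Gal(K/ℚ)` acts on `Hom_ℚ(K, K)` with trivial point stabilisers (an endomorphism of the number field `K` is
surjective). [folklore] -/
private theorem stabilizer_algHom_eq_bot (χ₀ : K →ₐ[ℚ] K) : MulAction.stabilizer (K ≃ₐ[ℚ] K) χ₀ = ⊥ := by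
  rw [Subgroup.eq_bot_iff_forall]
  intro g hg
  rw [MulAction.mem_stabilizer_iff] at hg
  have hs : Function.Surjective χ₀ := (Algebra.IsAlgebraic.algHom_bijective χ₀).2
  ext x
  obtain ⟨y, rfl⟩ := hs x
  exact AlgHom.congr_fun hg y

variable [IsGalois ℚ K] [IsMulCommutative (K ≃ₐ[ℚ] K)]

/-- For `K/ℚ` ABELIAN: a type `Ψ ⊆ Hom_ℚ(K, K)` is primitive iff `H* = Stab(Ψ)` is trivial.
[cite: Schmidt1984CMArithmetik, Kap. II Bem. 1.13] -/
theorem isPrimitive_iff_stabilizer_eq_bot (Ψ : Set (K →ₐ[ℚ] K)) (χ₀ : K →ₐ[ℚ] K) :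
    IsPrimitive (K ≃ₐ[ℚ] K) Ψ χ₀ ↔ MulAction.stabilizer (K ≃ₐ[ℚ] K) Ψ = ⊥ := by
  rw [isPrimitive_iff_stabilizer_le_of_comm (fun a b => IsMulCommutative.is_comm.comm a b) Ψ χ₀,
    stabilizer_algHom_eq_bot, le_bot_iff]

/-- **Bem. 1.13 at the Galois level**: for `K/ℚ` abelian, `Ψ ⊆ Hom_ℚ(K, K)` is primitive iff its reflex field
`K* = reflexField ℚ K Ψ` («the subfield corresponding to `H*`») has full degree `[K* : ℚ] = [K : ℚ]`
(`[K* : ℚ] = |Gal • Ψ|`, orbit–stabiliser). [cite: Schmidt1984CMArithmetik, Kap. II Bem. 1.13]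
[cite: Shimura1998, §8.3 Prop. 28] -/
theorem isPrimitive_iff_finrank_reflexField_eq (Ψ : Set (K →ₐ[ℚ] K)) (χ₀ : K →ₐ[ℚ] K) :
    IsPrimitive (K ≃ₐ[ℚ] K) Ψ χ₀ ↔ Module.finrank ℚ (reflexField ℚ K Ψ) = Module.finrank ℚ K := by
  rw [isPrimitive_iff_stabilizer_eq_bot, finrank_reflexField_eq_card_orbit, ← IsGalois.card_aut_eq_finrank ℚ K,
    ← Subgroup.card_eq_one]
  have h := Subgroup.card_mul_index (MulAction.stabilizer (K ≃ₐ[ℚ] K) Ψ)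
  rw [MulAction.index_stabilizer, ← Nat.card_coe_set_eq] at h
  have hpos : 0 < Nat.card (K ≃ₐ[ℚ] K) := Nat.card_pos
  constructor
  · intro h1
    rw [h1, one_mul] at h
    exact h
  · intro h2
    rw [h2] at h
    exact Nat.eq_of_mul_eq_mul_right hpos (h.trans (one_mul _).symm)

/-- … iff `K* = K` («`K = K'`»). [cite: Schmidt1984CMArithmetik, Kap. II Bem. 1.13] -/
theorem isPrimitive_iff_reflexField_eq_top (Ψ : Set (K →ₐ[ℚ] K)) (χ₀ : K →ₐ[ℚ] K) :
    IsPrimitive (K ≃ₐ[ℚ] K) Ψ χ₀ ↔ reflexField ℚ K Ψ = ⊤ := by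
  rw [isPrimitive_iff_finrank_reflexField_eq]
  constructor
  · intro h
    exact IntermediateField.eq_of_le_of_finrank_eq le_top (by rw [h, IntermediateField.finrank_top'])
  · intro h
    rw [h, IntermediateField.finrank_top']

end GalLevel

/-! ## §3 Complex CM types of an abelian CM field -/

section ComplexLevel

variable {K : Type} [Field K] [NumberField K] [IsGalois ℚ K] [IsMulCommutative (K ≃ₐ[ℚ] K)]

/-- **SCHMIDT Bem. 1.13 for complex CM types.**  `K` a CM field ABELIAN over `ℚ`, `Θ : CMType K`, `ι, φ₀` any
complex embeddings.  Then `Θ` is primitive (the tree's `IsPrimitive (ℂ ≃+* ℂ) Θ φ₀`) iff the reflex field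
`K* = reflexField ℚ K (algValuedIn ι Θ)` of `Θ` read in `K` through `ι` has degree `[K : ℚ]`.
[cite: Schmidt1984CMArithmetik, Kap. II Bem. 1.13] [cite: Shimura1998, §8.3 Prop. 28] -/
theorem isPrimitive_iff_finrank_reflexField_algValuedIn_eq (Θ : CMType K) (ι φ₀ : K →+* ℂ) :
    IsPrimitive (ℂ ≃+* ℂ) Θ.1 φ₀ ↔
      Module.finrank ℚ (reflexField ℚ K (algValuedIn ι Θ.1)) = Module.finrank ℚ K := by
  rw [← isPrimitive_algValuedIn_iff (AlgHom.id ℚ K) ι Θ.1 (AlgHom.id ℚ K) φ₀]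
  exact isPrimitive_iff_finrank_reflexField_eq _ _

/-- … iff **`K* = K`** («genau dann, wenn `K = K'` ist»; `⟹` is the tree's
`reflexField_eq_top_of_isPrimitive_of_comm`, Shimura §8.4 Example (1)).
[cite: Schmidt1984CMArithmetik, Kap. II Bem. 1.13] [cite: Shimura1998, §8.4 Example (1)] -/
theorem isPrimitive_iff_reflexField_algValuedIn_eq_top (Θ : CMType K) (ι φ₀ : K →+* ℂ) :
    IsPrimitive (ℂ ≃+* ℂ) Θ.1 φ₀ ↔ reflexField ℚ K (algValuedIn ι Θ.1) = ⊤ := by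
  rw [← isPrimitive_algValuedIn_iff (AlgHom.id ℚ K) ι Θ.1 (AlgHom.id ℚ K) φ₀]
  exact isPrimitive_iff_reflexField_eq_top _ _

/-- **Model-free form**: `Θ` is primitive iff Shimura's complex reflex field
`ℚ(tr_Θ(K)) = ℚ(∑_{φ ∈ Θ} φ(ξ) | ξ ∈ K) ⊂ ℂ` (the tree's `traceField Θ`, `= ι(K*)` by `map_reflexField_algValuedIn`)
has degree `[K : ℚ]` (`⟹`, as `traceField Θ = x(K)`, is the tree's `traceField_eq_fieldRange_of_isPrimitive_of_comm`).
[cite: Schmidt1984CMArithmetik, Kap. II Bem. 1.13] [cite: Shimura1998, §8.3 Prop. 28, §8.4 Example (1)] -/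
theorem isPrimitive_iff_finrank_traceField_eq (Θ : CMType K) (φ₀ : K →+* ℂ) :
    IsPrimitive (ℂ ≃+* ℂ) Θ.1 φ₀ ↔ Module.finrank ℚ (traceField Θ) = Module.finrank ℚ K := by
  obtain ⟨ι⟩ : Nonempty (K →+* ℂ) := inferInstance
  rw [isPrimitive_iff_finrank_reflexField_algValuedIn_eq Θ ι φ₀, finrank_traceField_eq_finrank_reflexField
    (AlgHom.id ℚ K) ι Θ]

/-- **Abelian varieties**: an abelian variety of CM type `(K; Θ)` with `K` ABELIAN over `ℚ` is simple iff
`[ℚ(tr_Θ(K)) : ℚ] = [K : ℚ]` (Shimura §8.2 Prop. 26 «primitive iff simple» = tree `isSimple_iff_isPrimitive`).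
[cite: Schmidt1984CMArithmetik, Kap. II Bem. 1.13] [cite: Shimura1998, §8.2 Prop. 26 and §8.3 Prop. 28] -/
theorem isSimple_iff_finrank_traceField_eq [IsCMField K] (Θ : CMType K) {A : AbelianVariety ℂ}
    {i : 𝓞 K →+* End A}
    {θ : K →+* Module.End ℂ (complexBetti A.X 1)} (hA : IsCMTypeRealisation Θ A i θ) :
    A.IsSimple ↔ Module.finrank ℚ (traceField Θ) = Module.finrank ℚ K := by
  rw [isSimple_iff_isPrimitive hA (Classical.arbitrary _)]
  exact isPrimitive_iff_finrank_traceField_eq Θ _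

end ComplexLevel

end PrimitiveCMTypeAbelianReflex

end Literature.NumberTheory.ComplexMultiplication

end
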